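import Summits.Ventures.DiscreteObjects.Hadamard.Order167InvertingNormalizer668
import Summits.Ventures.DiscreteObjects.Hadamard.InvolutionTypeII

/-!
# H(668): an involution inverting an element of order 167 preserves ALL four blocks (4 fixed rows; H is then a symmetric
# 16-circulant array) or NONE (fixed-point-free, nega) — no mixed case (kernel)

Framing: lottery ticket; floor = certified bounds/negative ranges.

Cell pub-namedobj (venture DiscreteObjects), target (H), hadamard gen 21.  Companion of gen 20's `Order167InvertingNormalizer668`
(block-preserving inversion of `σ₁₆₇` ⇔ symmetric `4 × 4` circulant array).  Let `σ = (π, κ, d, e)` be a signed automorphism of a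
Hadamard matrix `H` of order `668` with `π^167 = κ^167 = 1`, `(π, κ) ≠ (1,1)` (fixed-point-free, `4 + 4` orbits), and
`τ = (π', κ', d', e')` a signed automorphism INVERTING it: `π'π = π^μ π'`, `κ'κ = κ^μ κ'`, `μ ≡ 166 (mod 167)`, whose pair is a
non-trivial involution.
* `inverting_fixed_orbit_unique`, `card_fixed_le_classes_of_inverting`: on each `σ`-orbit `τ` acts as `s ↦ −s + c`, so it has
  AT MOST ONE fixed point per orbit: `#Fix π' ≤ 4`; `rows_preserved_of_card_fixed`: if `#Fix π' = 4` every orbit carries a fixed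
  point and is preserved.
* **`hadamard668_order167_inverting_involution`** (all-or-none): EITHER `τ` preserves every row orbit and every column orbit and
  fixes exactly `4` rows and `4` columns (one per block), OR `τ` preserves no row orbit and no column orbit, fixes nothing and is
  nega (`d' (π' i) = −d' i`, `e' (κ' j) = −e' j`) [involution census, gen 13: type I needs `f ≡ 4 (mod 8)`, and `f ≤ 4`; type III
  is fixed-point-free; an orbit preserved by an inverting map carries a fixed point (`inverting_fixed_point`, gen 20)].  The mixed
  case 'two blocks reversed in place, two blocks exchanged' is EXCLUDED.
* **`hadamard668_order167_inverting_involution_symmetricArray`**: in the first case `H` is equivalent to a Hadamard `4 × 4` array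
  of SYMMETRIC circulant blocks of order `167` (gen 20's dictionary applies) — the shape of the Williamson array with symmetric
  `A, B, C, D` and its block reversal; in the second case `⟨σ, τ⟩` is dihedral of order `334` at the pair level, `τ` exchanging
  the four blocks in two pairs without fixed points.
STRUCTURE of a hypothetical object; no automorphism order and no Hadamard order is excluded; H(668) untouched; HITS 0/4.  Ours; no
`sorry`, no definitions, default heartbeats.
-/

namespace Summit.Ventures.DiscreteObjects.Hadamard

open Finset BigOperators Matrix

open Literature.Combinatorics.Designs.GoethalsSeidel (IsHadamardMatrix)

variable {ι : Type*} [Fintype ι] [DecidableEq ι]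

/-! ### an inverting permutation has at most one fixed point per orbit -/

section perm
variable {π ψ : Equiv.Perm ι} {μ : ℕ} (hn : ψ * π = π ^ μ * ψ) (hπ : π ^ 167 = 1) (hμ : μ % 167 = 166)
  (hπfix : ∀ x, π x ≠ x)
include hn hπ hμ hπfix

omit [Fintype ι] in
/-- two `ψ`-fixed points in one `π`-orbit coincide (`ψ` acts on the orbit as `s ↦ −s + c`, and `2` is invertible mod `167`) -/
lemma inverting_fixed_orbit_unique {x y : ι} (hx : ψ x = x) (hy : ψ y = y) (hmem : y ∈ orbFin π 167 x) : y = x := by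
  have p167 : Nat.Prime 167 := by norm_num
  obtain ⟨k, hk, rfl⟩ := Finset.mem_image.mp hmem
  rw [Finset.mem_range] at hk
  rw [norm_apply_pow hn k x, hx, ← pow_mod_of_pow_eq_one π hπ (μ * k)] at hy
  have hk' : (μ * k) % 167 = k := perm_pow_apply_injective π p167 hπ (hπfix x) (Nat.mod_lt _ (by norm_num)) hk hy
  rw [Nat.mul_mod, hμ, Nat.mod_eq_of_lt hk] at hk'
  have hk0 : k = 0 := by omega
  rw [hk0, pow_zero, Equiv.Perm.one_apply]

/-- hence `#Fix ψ ≤ #classes of π` -/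
lemma card_fixed_le_classes_of_inverting : (univ.filter fun x => ψ x = x).card ≤ (blockClasses π 167).card := by
  refine Finset.card_le_card_of_injOn (fun x => orbFin π 167 x) ?_ ?_
  · intro x _
    exact Finset.mem_coe.mpr (Finset.mem_image_of_mem _ (Finset.mem_filter.mpr ⟨Finset.mem_univ _, hπfix x⟩))
  · intro x hx y hy hxy
    have hx' : ψ x = x := (Finset.mem_filter.mp (Finset.mem_coe.mp hx)).2
    have hy' : ψ y = y := (Finset.mem_filter.mp (Finset.mem_coe.mp hy)).2
    have hmem : y ∈ orbFin π 167 x := by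
      have e : orbFin π 167 x = orbFin π 167 y := hxy
      rw [e]; exact mem_orbFin_self π (by norm_num) y
    exact (inverting_fixed_orbit_unique hn hπ hμ hπfix hx' hy' hmem).symm

/-- if `ψ` fixes as many points as `π` has classes, every orbit carries a fixed point and is preserved by `ψ` -/
lemma rows_preserved_of_card_fixed (hcard : (univ.filter fun x => ψ x = x).card = (blockClasses π 167).card) :
    ∀ x, ψ x ∈ orbFin π 167 x := by
  have p167 : Nat.Prime 167 := by norm_num
  -- the image of the fixed set under `orbFin` is all of `blockClasses`
  have hinj : Set.InjOn (fun x => orbFin π 167 x) ↑(univ.filter fun x => ψ x = x) := by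
    intro x hx y hy hxy
    have hx' : ψ x = x := (Finset.mem_filter.mp (Finset.mem_coe.mp hx)).2
    have hy' : ψ y = y := (Finset.mem_filter.mp (Finset.mem_coe.mp hy)).2
    have hmem : y ∈ orbFin π 167 x := by
      have e : orbFin π 167 x = orbFin π 167 y := hxy
      rw [e]; exact mem_orbFin_self π (by norm_num) y
    exact (inverting_fixed_orbit_unique hn hπ hμ hπfix hx' hy' hmem).symm
  have hsub : (univ.filter fun x => ψ x = x).image (fun x => orbFin π 167 x) ⊆ blockClasses π 167 := by
    intro C hC
    obtain ⟨x, -, rfl⟩ := Finset.mem_image.mp hC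
    exact Finset.mem_image_of_mem _ (Finset.mem_filter.mpr ⟨Finset.mem_univ _, hπfix x⟩)
  have heq : (univ.filter fun x => ψ x = x).image (fun x => orbFin π 167 x) = blockClasses π 167 := by
    apply Finset.eq_of_subset_of_card_le hsub
    rw [Finset.card_image_of_injOn hinj, hcard]
  intro x
  have hC : orbFin π 167 x ∈ (univ.filter fun x => ψ x = x).image (fun x => orbFin π 167 x) := by
    rw [heq]; exact Finset.mem_image_of_mem _ (Finset.mem_filter.mpr ⟨Finset.mem_univ _, hπfix x⟩)
  obtain ⟨y, hy, hyx⟩ := Finset.mem_image.mp hC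
  have hy' : ψ y = y := (Finset.mem_filter.mp hy).2
  -- x lies in the orbit of the fixed point y
  have hxmem : x ∈ orbFin π 167 y := by
    have h : x ∈ orbFin π 167 x := mem_orbFin_self π (by norm_num) x
    rwa [← hyx] at h
  obtain ⟨k, -, rfl⟩ := Finset.mem_image.mp hxmem
  rw [norm_apply_pow hn k y, hy', orbFin_eq_of_mem π p167 hπ (hπfix y) hxmem]
  exact pow_apply_mem_orbFin π (by norm_num) hπ y _

omit hπfix in
/-- an orbit preserved by `ψ` carries a fixed point; so no fixed point ⇒ no orbit preserved -/
lemma not_mem_orbFin_of_no_fixed (h0 : (univ.filter fun x => ψ x = x).card = 0) : ∀ x, ψ x ∉ orbFin π 167 x := by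
  intro x hx
  obtain ⟨c, -, hc⟩ := Finset.mem_image.mp hx
  exact moved_of_card_fixed_eq_zero ψ h0 _ (inverting_fixed_point hn hπ hμ hc.symm)

end perm

/-! ### inverting involutions: all blocks or none -/

section main
variable {H : Matrix ι ι ℤ} (hH : IsHadamardMatrix H) (hι : Fintype.card ι = 668)
  {π κ π' κ' : Equiv.Perm ι} {d e d' e' : ι → ℤ} (haut : IsSignedAut H π κ d e)
  (hπ : π ^ 167 = 1) (hκ : κ ^ 167 = 1) (hne : π ≠ 1 ∨ κ ≠ 1)
  (haut' : IsSignedAut H π' κ' d' e') {μ : ℕ} (hnπ : π' * π = π ^ μ * π') (hnκ : κ' * κ = κ ^ μ * κ')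
  (hμ : μ % 167 = 166) (h2 : π' ^ 2 = 1) (h2' : κ' ^ 2 = 1) (hne' : π' ≠ 1 ∨ κ' ≠ 1)
include hH hι haut hπ hκ hne haut' hnπ hnκ hμ h2 h2' hne'

/-- **All-or-none for inverting involutions.**  An involution inverting an element of order `167` either preserves every row
orbit and every column orbit, fixing exactly `4` rows and `4` columns, or preserves no orbit at all and is nega (fixed-point-free,
signs alternating along its `2`-cycles). -/
theorem hadamard668_order167_inverting_involution :
    ((∀ x, π' x ∈ orbFin π 167 x) ∧ (∀ y, κ' y ∈ orbFin κ 167 y) ∧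
      (univ.filter fun x => π' x = x).card = 4 ∧ (univ.filter fun y => κ' y = y).card = 4) ∨
    ((∀ x, π' x ∉ orbFin π 167 x) ∧ (∀ y, κ' y ∉ orbFin κ 167 y) ∧
      (univ.filter fun x => π' x = x).card = 0 ∧ (univ.filter fun y => κ' y = y).card = 0 ∧
      (∀ i, d' (π' i) = -d' i) ∧ (∀ j, e' (κ' j) = -e' j)) := by
  have h167 := hadamard668_fixedRows_167 hH hι π κ d e haut hπ hκ hne
  have hπfix : ∀ x, π x ≠ x := moved_of_card_fixed_eq_zero π h167.1
  have hκfix : ∀ y, κ y ≠ y := moved_of_card_fixed_eq_zero κ h167.2.1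
  have hle := card_fixed_le_classes_of_inverting hnπ hπ hμ hπfix
  rw [h167.2.2.1] at hle
  obtain ⟨-, -, hcases⟩ := hadamard668_involution_census_final hH hι π' κ' d' e' haut' h2 h2' hne'
  rcases hcases with ⟨heq, -, h4, -, -⟩ | ⟨h0, h0', hd, he⟩
  · left
    have hr : (univ.filter fun x => π' x = x).card = 4 := le_antisymm hle h4
    have hc : (univ.filter fun y => κ' y = y).card = 4 := by rw [← heq, hr]
    refine ⟨rows_preserved_of_card_fixed hnπ hπ hμ hπfix (by rw [hr, h167.2.2.1]),
      rows_preserved_of_card_fixed hnκ hκ hμ hκfix (by rw [hc, h167.2.2.2]), hr, hc⟩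
  · right
    exact ⟨not_mem_orbFin_of_no_fixed hnπ hπ hμ h0, not_mem_orbFin_of_no_fixed hnκ hκ hμ h0', h0, h0', hd, he⟩

/-- **If an inverting involution has a fixed row (equivalently preserves one block), `H` is a symmetric 16-circulant array**:
there is a Hadamard `4 × 4` array of SYMMETRIC circulant `±1` blocks of order `167` (gen 20's dictionary in the all-blocks case). -/
theorem hadamard668_order167_inverting_involution_symmetricArray (hfix : ∃ x, π' x = x) :
    ∃ x : Fin 4 → Fin 4 → ZMod 167 → ℤ,
      IsHadamardMatrix (Matrix.of fun (a b : Fin 4 × ZMod 167) => x a.1 b.1 (b.2 - a.2)) ∧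
      Fintype.card (Fin 4 × ZMod 167) = 668 ∧ ∀ p q r, x p q (-r) = x p q r := by
  rcases hadamard668_order167_inverting_involution hH hι haut hπ hκ hne haut' hnπ hnκ hμ h2 h2' hne' with
    ⟨hrows, hcols, -, -⟩ | ⟨-, -, h0, -⟩
  · exact exists_symmetricCirculantArray_of_inverting hH hι haut hπ hκ hne haut' hnπ hnκ hμ hrows hcols
  · exfalso
    obtain ⟨x, hx⟩ := hfix
    exact moved_of_card_fixed_eq_zero π' h0 x hx

end main

end Summit.Ventures.DiscreteObjects.Hadamard
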